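import Literature.Topology.FourManifolds.TorusCoordinates
import Literature.Topology.FourManifolds.NonSeparatingSpheresStandardLoop
import HarnessLib

/-!
# Disc extension, layer 0: the circle `𝕊¹ ⊆ ℝ²` versus the Lie group `Circle ⊆ ℂ`

Auxiliary file of helper `helper_sliceGluing_discExtension` (apex leaf DX: extension of the
torus angular coordinate over the torus disc), line `Sketch`, crux `SblfDescent.RungOne`.

(Crux item stmt-SmoothPoincare4-18531; skeleton `Cruxes/RungOne/Lines/Sketch.lean`.)

The collar bricks of the crux speak about the unit circle `𝕊¹ = Metric.sphere (0 : ℝ²) 1`,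
whereas the Earle–Eells/Gramain input (`gramain_loopHomotopy_translationLoop_torus`,
`TorusDiffeoLoops.lean`) speaks about Mathlib's Lie group `Circle ⊆ ℂ`.  Here we record the
diffeomorphism `circleDiffeo : 𝕊¹ ≃ₘ Circle`, `(x, y) ↦ x + iy` (the tree's `toCircle`,
`TorusCoordinates.lean`, with inverse `ofCircle z = (re z, im z)`), and the elementary lifting
fact: a *continuous* real function `g` whose exponential `t ↦ e^{2πi g(t)}` is smooth is itself
smooth (locally `g = g(t₀) + arg(e^{2πi (g - g t₀)}) / 2π` with `arg` real-analytic on the slit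
plane).  Everything is folklore calculus.
-/

set_option linter.dupNamespace false

noncomputable section

open scoped Manifold ContDiff Topology Real
open Set Function Metric Complex Literature.Topology.FourManifolds

namespace Summit.SmoothPoincare4.SmoothPoincare4.Cruxes.RungOne.Sketch

namespace DiscExt

/-- Local notation: `𝔼 n` is the model Euclidean space `EuclideanSpace ℝ (Fin n)`. -/
local notation "𝔼 " n:arg => EuclideanSpace ℝ (Fin n)

/-- Local notation: `𝕊¹`, the unit circle of `ℝ²`. -/
local notation "𝕊¹" => (Metric.sphere (0 : EuclideanSpace ℝ (Fin 2)) (1 : ℝ))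

attribute [local instance] Literature.Topology.FourManifolds.fact_finrank_euclideanSpace_succ
attribute [local instance] finrank_real_complex_fact'

/-! ### `ofCircle : Circle → 𝕊¹`, the inverse of `toCircle` -/

/-- The vector `(re z, im z) ∈ ℝ²` of a complex number. [folklore] -/
def vecOfC (z : ℂ) : 𝔼 2 := (EuclideanSpace.equiv (Fin 2) ℝ).symm ![z.re, z.im]

/-- First coordinate of `vecOfC`. [folklore] -/
@[simp] theorem vecOfC_apply_zero (z : ℂ) : vecOfC z 0 = z.re := rfl

/-- Second coordinate of `vecOfC`. [folklore] -/
@[simp] theorem vecOfC_apply_one (z : ℂ) : vecOfC z 1 = z.im := rfl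

/-- `toC (vecOfC z) = z`. [folklore] -/
@[simp] theorem toC_vecOfC (z : ℂ) : toC (vecOfC z) = z := Complex.ext rfl rfl

/-- `vecOfC (toC w) = w`. [folklore] -/
@[simp] theorem vecOfC_toC (w : 𝔼 2) : vecOfC (toC w) = w := by
  ext i; fin_cases i <;> rfl

/-- `vecOfC` is smooth (it is real linear). [folklore] -/
theorem contDiff_vecOfC : ContDiff ℝ ∞ vecOfC := by
  have : vecOfC = fun z ↦ (EuclideanSpace.equiv (Fin 2) ℝ).symm ![z.re, z.im] := rfl
  rw [this, show (fun z : ℂ ↦ (EuclideanSpace.equiv (Fin 2) ℝ).symm ![z.re, z.im]) =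
    (EuclideanSpace.equiv (Fin 2) ℝ).symm ∘ fun z : ℂ ↦ ![z.re, z.im] from rfl]
  refine (EuclideanSpace.equiv (Fin 2) ℝ).symm.contDiff.comp ?_
  rw [contDiff_pi]
  intro i
  fin_cases i
  · exact Complex.reCLM.contDiff
  · exact Complex.imCLM.contDiff

/-- `‖vecOfC z‖ = ‖z‖`. [folklore] -/
theorem norm_vecOfC (z : ℂ) : ‖vecOfC z‖ = ‖z‖ := by
  rw [← norm_toC, toC_vecOfC]

/-- **The inverse identification** `ofCircle : Circle → 𝕊¹`, `z ↦ (re z, im z)`. [folklore] -/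
def ofCircle (z : Circle) : 𝕊¹ :=
  ⟨vecOfC z, by rw [mem_sphere_zero_iff_norm, norm_vecOfC, Circle.norm_coe]⟩

/-- The vector underlying `ofCircle z`. [folklore] -/
@[simp] theorem coe_ofCircle (z : Circle) : ((ofCircle z : 𝕊¹) : 𝔼 2) = vecOfC z := rfl

/-- `toCircle (ofCircle z) = z`. [folklore] -/
@[simp] theorem toCircle_ofCircle (z : Circle) : toCircle (ofCircle z) = z :=
  Circle.ext (by rw [coe_toCircle, coe_ofCircle, toC_vecOfC])

/-- `ofCircle (toCircle u) = u`. [folklore] -/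
@[simp] theorem ofCircle_toCircle (u : 𝕊¹) : ofCircle (toCircle u) = u :=
  Subtype.ext (by rw [coe_ofCircle, coe_toCircle, vecOfC_toC])

/-- `ofCircle` is smooth. [folklore] -/
theorem contMDiff_ofCircle : ContMDiff (𝓡 1) (𝓡 1) ∞ ofCircle :=
  (contDiff_vecOfC.contMDiff.comp contMDiff_coe_sphere).codRestrict_sphere _

/-- **`𝕊¹ ≅ Circle` as a diffeomorphism** (`toCircle` with inverse `ofCircle`). [folklore] -/
def circleDiffeo : 𝕊¹ ≃ₘ⟮𝓡 1, 𝓡 1⟯ Circle where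
  toFun := toCircle
  invFun := ofCircle
  left_inv := ofCircle_toCircle
  right_inv := toCircle_ofCircle
  contMDiff_toFun := contMDiff_toCircle
  contMDiff_invFun := contMDiff_ofCircle

/-- `circleDiffeo` is `toCircle` on points. [folklore] -/
@[simp] theorem circleDiffeo_apply (u : 𝕊¹) : circleDiffeo u = toCircle u := rfl

/-- `circleDiffeo.symm` is `ofCircle` on points. [folklore] -/
@[simp] theorem circleDiffeo_symm_apply (z : Circle) : circleDiffeo.symm z = ofCircle z := rfl

/-- **`𝕊¹ × 𝕊¹ ≅ Circle × Circle`** componentwise. [folklore] -/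
def torusDiffeo : (𝕊¹ × 𝕊¹) ≃ₘ⟮(𝓡 1).prod (𝓡 1), (𝓡 1).prod (𝓡 1)⟯ (Circle × Circle) :=
  circleDiffeo.prodCongr circleDiffeo

/-- `torusDiffeo` on points. [folklore] -/
@[simp] theorem torusDiffeo_apply (p : 𝕊¹ × 𝕊¹) : torusDiffeo p = (toCircle p.1, toCircle p.2) := rfl

/-- `torusDiffeo.symm` on points. [folklore] -/
@[simp] theorem torusDiffeo_symm_apply (q : Circle × Circle) :
    torusDiffeo.symm q = (ofCircle q.1, ofCircle q.2) := rfl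

/-- `ofCircle (exp (2πθ i)) = circlePt θ`. [folklore] -/
@[simp] theorem ofCircle_exp (θ : ℝ) : ofCircle (Circle.exp (2 * π * θ)) = circlePt θ := by
  rw [← toCircle_circlePt, ofCircle_toCircle]

/-! ### A continuous lift of a smooth circle-valued function is smooth -/

/-- The exponential `e^{ix}` lies in the slit plane when `|x| < π`. [folklore] -/
theorem exp_mul_I_mem_slitPlane {x : ℝ} (h₁ : -π < x) (h₂ : x < π) :
    Complex.exp (x * I) ∈ slitPlane := by
  have hmem : x ∈ Set.Ioc (-π) (-π + 2 * π) := ⟨h₁, by linarith⟩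
  rw [mem_slitPlane_iff_arg, Complex.arg_exp_mul_I, (toIocMod_eq_self _).2 hmem]
  exact ⟨h₂.ne, Complex.exp_ne_zero _⟩

/-- **Smoothness of continuous lifts.** If `g : ℝ → ℝ` is continuous and the complex
exponential `t ↦ e^{2πi g(t)}` is `C^∞` (as a map into `ℂ`), then `g` is `C^∞`: near `t₀`,
`g(t) = g(t₀) + arg (e^{2πi (g t - g t₀)}) / (2π)` and `arg` is smooth on the slit plane.
[folklore] -/
theorem contDiff_of_continuous_of_contDiff_exp {g : ℝ → ℝ} (hg : Continuous g)
    (he : ContDiff ℝ ∞ fun t ↦ Complex.exp ((2 * π * g t : ℝ) * I)) : ContDiff ℝ ∞ g := by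
  have hπ : 0 < π := Real.pi_pos
  refine contDiff_iff_contDiffAt.2 fun t₀ ↦ ?_
  -- near `t₀`, `|g t - g t₀| < 1/4`
  have hnear : ∀ᶠ t in 𝓝 t₀, |g t - g t₀| < 1 / 4 := by
    have h := (hg.tendsto t₀).eventually (Metric.ball_mem_nhds (g t₀) (by norm_num : (0:ℝ) < 1/4))
    filter_upwards [h] with t ht
    rwa [Real.dist_eq] at ht
  -- the candidate smooth formula
  set c : ℂ := Complex.exp (-((2 * π * g t₀ : ℝ) * I)) with hc
  set G : ℝ → ℝ := fun t ↦ g t₀ + arg (Complex.exp ((2 * π * g t : ℝ) * I) * c) / (2 * π) with hG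
  have hprod : ∀ t, Complex.exp ((2 * π * g t : ℝ) * I) * c =
      Complex.exp ((2 * π * (g t - g t₀) : ℝ) * I) := by
    intro t
    rw [hc, ← Complex.exp_add]
    congr 1
    push_cast
    ring
  have hGeq : ∀ᶠ t in 𝓝 t₀, g t = G t := by
    filter_upwards [hnear] with t ht
    have h1 : -π < 2 * π * (g t - g t₀) := by nlinarith [(abs_lt.1 ht).1]
    have h2 : 2 * π * (g t - g t₀) < π := by nlinarith [(abs_lt.1 ht).2]
    rw [hG]
    dsimp only
    have hmem : 2 * π * (g t - g t₀) ∈ Set.Ioc (-π) (-π + 2 * π) := ⟨h1, by linarith⟩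
    rw [hprod t, Complex.arg_exp_mul_I, (toIocMod_eq_self _).2 hmem]
    field_simp
    ring
  refine ContDiffAt.congr_of_eventuallyEq ?_ hGeq
  -- `G` is smooth at `t₀`
  have hslit : Complex.exp ((2 * π * g t₀ : ℝ) * I) * c ∈ slitPlane := by
    rw [hprod t₀, sub_self, mul_zero]
    push_cast
    rw [zero_mul, Complex.exp_zero]
    exact one_mem_slitPlane
  have h1 : ContDiffAt ℝ ∞ (fun t ↦ Complex.exp ((2 * π * g t : ℝ) * I) * c) t₀ :=
    he.contDiffAt.mul contDiffAt_const
  have h2 : ContDiffAt ℝ ∞ (fun t ↦ arg (Complex.exp ((2 * π * g t : ℝ) * I) * c)) t₀ :=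
    ContDiffAt.comp (g := arg) t₀ (contDiffAt_arg hslit) h1
  exact contDiffAt_const.add (h2.div_const _)

/-- **Smoothness of continuous lifts, `Circle`-valued form.** If `g : ℝ → ℝ` is continuous and
`t ↦ Circle.exp (2π g t)` is `C^∞` into the Lie group `Circle`, then `g` is `C^∞`. [folklore] -/
theorem contDiff_of_continuous_of_contMDiff_circleExp {g : ℝ → ℝ} (hg : Continuous g)
    (he : ContMDiff 𝓘(ℝ, ℝ) (𝓡 1) ∞ fun t ↦ Circle.exp (2 * π * g t)) : ContDiff ℝ ∞ g := by
  refine contDiff_of_continuous_of_contDiff_exp hg ?_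
  have h1 : ContMDiff 𝓘(ℝ, ℝ) 𝓘(ℝ, ℂ) ∞ fun t ↦ ((Circle.exp (2 * π * g t) : Circle) : ℂ) :=
    contMDiff_coe_sphere.comp he
  have h2 : (fun t ↦ ((Circle.exp (2 * π * g t) : Circle) : ℂ)) =
      fun t ↦ Complex.exp ((2 * π * g t : ℝ) * I) := by
    funext t; rw [Circle.coe_exp]
  rw [h2] at h1
  exact contMDiff_iff_contDiff.1 h1

end DiscExt

end Summit.SmoothPoincare4.SmoothPoincare4.Cruxes.RungOne.Sketch

end
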